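import Summits.NavierStokesRegularity.NavierStokesRegularity.Theorems.OddMorawetzMorawetzKillsTypeISignedPermBasis

/-!
# Route OddMorawetz — `MorawetzKillsTypeI`, the infinitesimal tensor equations of an invariant density
(item stmt-NavierStokesRegularity-1377, stub `stub_infinitesimalInvariance`)

Let `m` be a smooth density on 3-jets `z = (z₀, z₁, z₂, z₃) ∈ Jet3` that is invariant under the jet action
`jetAct g` of every linear isometry `g` of `ℝ³`, and let `T := D³m(0)`.  For a skew operator `S` of `ℝ³`
(`S* = -S`; the three rotation generators `L₀, L₁, L₂` of the statement are the operators of the antisymmetric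
matrices `-ε_{a··}`) we prove the classical tensor-invariance equation
`T(ℓx, y, w) + T(x, ℓy, w) + T(x, y, ℓw) = 0`, where `ℓ` is the derivation of jets induced by `S`,
`ℓ(z₀, z₁, z₂, z₃) = (Sz₀, S∘z₁ − z₁∘S, S∘z₂ − z₂∘(S,1) − z₂∘(1,S), …)`.

Proof (one-parameter groups, no coordinates, no new definitions):
* `exp_smul_mem_unitary_of_skew` — the rotation `exp (θS)` is a unitary of the Hilbert space `ℝ³` because `θS`
  is skew-adjoint (`NormedSpace.exp_mem_unitary_of_mem_skewAdjoint`); Mathlib's `Unitary.linearIsometryEquiv`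
  packages it as a linear isometry equivalence whose inverse acts as `exp (-θS)` (`NormedSpace.star_exp`);
* `jetAct_expUnitary` — on jets it acts by `z_n ↦ exp (θS) ∘ z_n ∘ (exp (-θS), …, exp (-θS))`;
* `hasDerivAt_jetAct_expUnitary` — the `θ`-derivative at `0` of this action is `ℓ z`
  (`hasDerivAt_exp_smul_const'`, the bilinear Leibniz rule `ContinuousLinearMap.hasDerivAt_of_bilinear` for the
  outer composition, and the derivative `ContinuousMultilinearMap.hasFDerivAt` / `linearDeriv_apply` of the
  multilinear map `f ↦ z_n ∘ (f₁, …, f_n)` (`compContinuousLinearMapLRight`) for the inner one);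
* `iteratedFDeriv_three_jetDeriv_eq_zero` — for ANY curve of isometries `R θ` through the identity whose jet
  action has `θ`-derivative `ℓ` at `0`, `θ ↦ T(R_θ x, R_θ y, R_θ w)` is constant by invariance of `T` (the landed
  `iteratedFDeriv_three_zero_jetAct`), and its derivative at `0`, computed with the derivative of the trilinear
  map `T` along the curve, is the displayed sum; derivatives are unique.
The registered statement `stub_infinitesimalInvariance` is the case `S = Lₐ`, whose skewness is the matrix
identity `Lₐᴴ = -Lₐ` transported by the star-algebra isomorphism `Matrix.toEuclideanCLM` (`star_axisGen`).

Mathlib + the tree's `OddMorawetzLocalSymmetryDefs/Fields` (`jetAct`, `mlAct`) and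
`OddMorawetzMorawetzKillsTypeISignedPermBasis` (`iteratedFDeriv_three_zero_jetAct`); theorems only, no named
facts, no definitions.
-/

noncomputable section

set_option linter.dupNamespace false

namespace Summit.NavierStokesRegularity.NavierStokesRegularity.Theorems

open Summit.NavierStokesRegularity.NavierStokesRegularity.Theorems.OddMorawetz
open NormedSpace

/-! ### The one-parameter rotation groups `exp (θS)` of a skew operator `S` -/

/-- For a skew operator `S` of `ℝ³` (`S* = -S`) and real `θ`, `exp (θS)` is a unitary (orthogonal) operator. -/
theorem exp_smul_mem_unitary_of_skew (S : E3 →L[ℝ] E3) (hS : star S = -S) (θ : ℝ) :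
    exp (θ • S) ∈ unitary (E3 →L[ℝ] E3) := by
  letI : NormedAlgebra ℚ (E3 →L[ℝ] E3) := NormedAlgebra.restrictScalars ℚ ℝ (E3 →L[ℝ] E3)
  exact exp_mem_unitary_of_mem_skewAdjoint (by
    rw [skewAdjoint.mem_iff, star_smul, hS, star_trivial, smul_neg])

/-- The adjoint (= inverse) of the rotation `exp (θS)` is `exp (θ(-S)) = exp (-θS)`. -/
theorem star_exp_smul_of_skew (S : E3 →L[ℝ] E3) (hS : star S = -S) (θ : ℝ) :
    star (exp (θ • S)) = exp (θ • (-S)) := by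
  rw [star_exp, star_smul, hS, star_trivial]

/-- `θ ↦ exp (θS)` has derivative `S` at `θ = 0`. -/
theorem hasDerivAt_exp_smul_zero_clm (S : E3 →L[ℝ] E3) : HasDerivAt (fun θ : ℝ => exp (θ • S)) S 0 := by
  refine (hasDerivAt_exp_smul_const' (𝕂 := ℝ) S (0 : ℝ)).congr_deriv ?_
  have hz : (0 : ℝ) • S = 0 := zero_smul ℝ S
  rw [hz, exp_zero, mul_one]

/-- `exp (0 • S) = 1`. -/
theorem exp_zero_smul_clm (S : E3 →L[ℝ] E3) : exp ((0 : ℝ) • S) = 1 := by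
  have hz : (0 : ℝ) • S = 0 := zero_smul ℝ S
  rw [hz, exp_zero]

/-- Post-composition of a multilinear map of `ℝ³` with the identity operator. -/
theorem one_compContinuousMultilinearMap_e3 {n : ℕ} (X : E3 [×n]→L[ℝ] E3) :
    (1 : E3 →L[ℝ] E3).compContinuousMultilinearMap X = X :=
  ContinuousMultilinearMap.ext fun _ => rfl

/-- Pre-composition of a multilinear map of `ℝ³` with identity operators. -/
theorem compContinuousLinearMap_one_e3 {n : ℕ} (A : E3 [×n]→L[ℝ] E3) :
    (A.compContinuousLinearMap fun _ => (1 : E3 →L[ℝ] E3)) = A :=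
  ContinuousMultilinearMap.ext fun _ => rfl

/-! ### The action of unitaries and rotations on jets, and its derivative at `θ = 0` -/

/-- On `n`-multilinear maps, the isometry of a unitary `u` acts by `A ↦ u ∘ A ∘ (u*, …, u*)`. -/
theorem mlAct_unitary (u : unitary (E3 →L[ℝ] E3)) (n : ℕ) (A : E3 [×n]→L[ℝ] E3) :
    mlAct (Unitary.linearIsometryEquiv u) n A =
      (u : E3 →L[ℝ] E3).compContinuousMultilinearMap
        (A.compContinuousLinearMap fun _ => ((star u : unitary (E3 →L[ℝ] E3)) : E3 →L[ℝ] E3)) :=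
  ContinuousMultilinearMap.ext fun v => by rw [mlAct_apply]; rfl

/-- On 3-jets, the rotation `exp (θS)` (skew `S`) acts componentwise by `exp (θS)` on `z₀` and by the
conjugations `z_n ↦ exp (θS) ∘ z_n ∘ (exp (-θS), …, exp (-θS))`. -/
theorem jetAct_expUnitary (S : E3 →L[ℝ] E3) (hS : star S = -S) (θ : ℝ) (z : Jet3) :
    jetAct (Unitary.linearIsometryEquiv ⟨exp (θ • S), exp_smul_mem_unitary_of_skew S hS θ⟩) z =
      (exp (θ • S) z.1,
        (exp (θ • S)).compContinuousMultilinearMap (z.2.1.compContinuousLinearMap fun _ => exp (θ • (-S))),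
        (exp (θ • S)).compContinuousMultilinearMap (z.2.2.1.compContinuousLinearMap fun _ => exp (θ • (-S))),
        (exp (θ • S)).compContinuousMultilinearMap (z.2.2.2.compContinuousLinearMap fun _ => exp (θ • (-S)))) := by
  rw [jetAct_apply, mlAct_unitary, mlAct_unitary, mlAct_unitary, Unitary.coe_star, star_exp_smul_of_skew S hS]
  rfl

/-- At `θ = 0` the rotation acts trivially on jets. -/
theorem jetAct_expUnitary_zero (S : E3 →L[ℝ] E3) (hS : star S = -S) (z : Jet3) :
    jetAct (Unitary.linearIsometryEquiv ⟨exp ((0 : ℝ) • S), exp_smul_mem_unitary_of_skew S hS 0⟩) z = z := by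
  rw [jetAct_expUnitary S hS, exp_zero_smul_clm, exp_zero_smul_clm]
  simp only [one_compContinuousMultilinearMap_e3, compContinuousLinearMap_one_e3, one_apply_eq_self]

/-- The inner composition: `θ ↦ A ∘ (exp (-θS), …, exp (-θS))` has derivative `-∑ₛ A ∘ (1, …, S, …, 1)`
(the `S` in slot `s`) at `θ = 0` — the derivative of the continuous multilinear map `f ↦ A ∘ (f₁, …, f_n)`
along the curve. -/
theorem hasDerivAt_compContinuousLinearMap_exp (S : E3 →L[ℝ] E3) {n : ℕ} (A : E3 [×n]→L[ℝ] E3) :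
    HasDerivAt (fun θ : ℝ => A.compContinuousLinearMap fun _ => exp (θ • (-S)))
      (-∑ s, A.compContinuousLinearMap (Function.update (fun _ => ContinuousLinearMap.id ℝ E3) s S)) 0 := by
  have hV : HasDerivAt (fun θ : ℝ => fun _ : Fin n => exp (θ • (-S))) (fun _ => -S) 0 :=
    hasDerivAt_pi.2 fun _ => hasDerivAt_exp_smul_zero_clm (-S)
  have h := ((ContinuousMultilinearMap.compContinuousLinearMapLRight (E := fun _ : Fin n => E3) A).hasFDerivAt
    (fun _ : Fin n => exp ((0 : ℝ) • (-S)))).comp_hasDerivAt (0 : ℝ) hV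
  refine h.congr_deriv ?_
  rw [ContinuousMultilinearMap.linearDeriv_apply, exp_zero_smul_clm, ← Finset.sum_neg_distrib]
  refine Finset.sum_congr rfl fun s _ => ?_
  exact (ContinuousMultilinearMap.compContinuousLinearMapLRight
    (E := fun _ : Fin n => E3) A).toMultilinearMap.map_update_neg (fun _ => (1 : E3 →L[ℝ] E3)) s S

/-- The conjugation: `θ ↦ exp (θS) ∘ A ∘ (exp (-θS), …, exp (-θS))` has derivative
`S ∘ A - ∑ₛ A ∘ (1, …, S, …, 1)` at `θ = 0` (bilinear Leibniz rule for the outer composition). -/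
theorem hasDerivAt_conj_exp_jet (S : E3 →L[ℝ] E3) {n : ℕ} (A : E3 [×n]→L[ℝ] E3) :
    HasDerivAt (fun θ : ℝ =>
        (exp (θ • S)).compContinuousMultilinearMap (A.compContinuousLinearMap fun _ => exp (θ • (-S))))
      (S.compContinuousMultilinearMap A -
        ∑ s, A.compContinuousLinearMap (Function.update (fun _ => ContinuousLinearMap.id ℝ E3) s S)) 0 := by
  have hB := ContinuousLinearMap.hasDerivAt_of_bilinear
    (B := ContinuousLinearMap.compContinuousMultilinearMapL ℝ (fun _ : Fin n => E3) E3 E3)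
    (fun _ => hasDerivAt_exp_smul_zero_clm S) (fun _ => hasDerivAt_compContinuousLinearMap_exp S A)
  refine hB.congr_deriv ?_
  simp only [ContinuousLinearMap.compContinuousMultilinearMapL_apply]
  rw [exp_zero_smul_clm, exp_zero_smul_clm, one_compContinuousMultilinearMap_e3, compContinuousLinearMap_one_e3,
    neg_add_eq_sub]

/-- **Derivative of the jet action of the rotation group**: `d/dθ|₀ jetAct (exp θS) z = ℓ z`, `ℓ` the derivation of
jets induced by `S`, `(z₀, z₁, z₂, z₃) ↦ (Sz₀, S∘z₁ − z₁∘S, S∘z₂ − z₂∘(S,1) − z₂∘(1,S), S∘z₃ − ∑ₛ z₃∘(…S…))`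
(written exactly as the `ℓ` of the registered statement). -/
theorem hasDerivAt_jetAct_expUnitary (S : E3 →L[ℝ] E3) (hS : star S = -S) (z : Jet3) :
    HasDerivAt (fun θ : ℝ => jetAct (Unitary.linearIsometryEquiv ⟨exp (θ • S), exp_smul_mem_unitary_of_skew S hS θ⟩) z)
      ((S z.1,
        S.compContinuousMultilinearMap z.2.1 -
          ∑ s : Fin 1, z.2.1.compContinuousLinearMap (Function.update (fun _ => ContinuousLinearMap.id ℝ E3) s S),
        S.compContinuousMultilinearMap z.2.2.1 -
          ∑ s : Fin 2, z.2.2.1.compContinuousLinearMap (Function.update (fun _ => ContinuousLinearMap.id ℝ E3) s S),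
        S.compContinuousMultilinearMap z.2.2.2 -
          ∑ s : Fin 3, z.2.2.2.compContinuousLinearMap (Function.update (fun _ => ContinuousLinearMap.id ℝ E3) s S))
        : Jet3) 0 := by
  have h : (fun θ : ℝ => jetAct (Unitary.linearIsometryEquiv ⟨exp (θ • S), exp_smul_mem_unitary_of_skew S hS θ⟩) z) =
      fun θ => (exp (θ • S) z.1,
        (exp (θ • S)).compContinuousMultilinearMap (z.2.1.compContinuousLinearMap fun _ => exp (θ • (-S))),
        (exp (θ • S)).compContinuousMultilinearMap (z.2.2.1.compContinuousLinearMap fun _ => exp (θ • (-S))),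
        (exp (θ • S)).compContinuousMultilinearMap (z.2.2.2.compContinuousLinearMap fun _ => exp (θ • (-S)))) :=
    funext fun θ => jetAct_expUnitary S hS θ z
  rw [h]
  have h0 : HasDerivAt (fun θ : ℝ => exp (θ • S) z.1) (S z.1) 0 := by
    refine ((hasDerivAt_exp_smul_zero_clm S).clm_apply (hasDerivAt_const (0 : ℝ) z.1)).congr_deriv ?_
    rw [map_zero, add_zero]
  exact h0.prodMk ((hasDerivAt_conj_exp_jet S z.2.1).prodMk
    ((hasDerivAt_conj_exp_jet S z.2.2.1).prodMk (hasDerivAt_conj_exp_jet S z.2.2.2)))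

/-! ### The tensor equations -/

/-- **Infinitesimal invariance along a curve of isometries.** If a smooth density `m` on 3-jets is invariant under
the jet action of every linear isometry of `ℝ³`, `R θ` is a curve of linear isometries acting trivially on jets at
`θ = 0`, and `ℓ z` is the `θ`-derivative at `0` of `jetAct (R θ) z`, then `T = D³m(0)` satisfies
`T(ℓx, y, w) + T(x, ℓy, w) + T(x, y, ℓw) = 0`: the function `θ ↦ T(R_θ x, R_θ y, R_θ w)` is constant
(invariance of `T`, `iteratedFDeriv_three_zero_jetAct`) and its derivative at `0` is the displayed sum
(derivative of the trilinear `T` along the curve); derivatives are unique. -/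
theorem iteratedFDeriv_three_jetDeriv_eq_zero {m : Jet3 → ℝ} (hm : ContDiff ℝ (⊤ : ℕ∞) m)
    (hinv : ∀ (g : E3 ≃ₗᵢ[ℝ] E3) (z : Jet3), m (jetAct g z) = m z)
    (R : ℝ → (E3 ≃ₗᵢ[ℝ] E3)) (ℓ : Jet3 → Jet3) (hR0 : ∀ z, jetAct (R 0) z = z)
    (hRℓ : ∀ z, HasDerivAt (fun θ : ℝ => jetAct (R θ) z) (ℓ z) 0) (x y w : Jet3) :
    iteratedFDeriv ℝ 3 m 0 ![ℓ x, y, w] + iteratedFDeriv ℝ 3 m 0 ![x, ℓ y, w] +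
      iteratedFDeriv ℝ 3 m 0 ![x, y, ℓ w] = 0 := by
  have hc : HasDerivAt (fun θ : ℝ => fun i : Fin 3 => jetAct (R θ) (![x, y, w] i)) (fun i => ℓ (![x, y, w] i)) 0 :=
    hasDerivAt_pi.2 fun i => hRℓ (![x, y, w] i)
  have hc0 : (fun i : Fin 3 => jetAct (R 0) (![x, y, w] i)) = ![x, y, w] := funext fun i => hR0 (![x, y, w] i)
  have hd : HasDerivAt ((⇑(iteratedFDeriv ℝ 3 m 0)) ∘ fun θ : ℝ => fun i : Fin 3 => jetAct (R θ) (![x, y, w] i))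
      (((iteratedFDeriv ℝ 3 m 0).linearDeriv fun i : Fin 3 => jetAct (R 0) (![x, y, w] i))
        fun i => ℓ (![x, y, w] i)) 0 :=
    ((iteratedFDeriv ℝ 3 m 0).hasFDerivAt (fun i : Fin 3 => jetAct (R 0) (![x, y, w] i))).comp_hasDerivAt (0 : ℝ) hc
  rw [hc0, ContinuousMultilinearMap.linearDeriv_apply] at hd
  have hconst : ((⇑(iteratedFDeriv ℝ 3 m 0)) ∘ fun θ : ℝ => fun i : Fin 3 => jetAct (R θ) (![x, y, w] i)) =
      fun _ => iteratedFDeriv ℝ 3 m 0 ![x, y, w] :=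
    funext fun θ => iteratedFDeriv_three_zero_jetAct hm hinv (R θ) ![x, y, w]
  rw [hconst] at hd
  have h0 := hd.unique (hasDerivAt_const (0 : ℝ) (iteratedFDeriv ℝ 3 m 0 ![x, y, w]))
  rw [Fin.sum_univ_three] at h0
  have e0 : Function.update ![x, y, w] 0 (ℓ (![x, y, w] 0)) = ![ℓ x, y, w] := by
    funext i; fin_cases i <;> rfl
  have e1 : Function.update ![x, y, w] 1 (ℓ (![x, y, w] 1)) = ![x, ℓ y, w] := by
    funext i; fin_cases i <;> rfl
  have e2 : Function.update ![x, y, w] 2 (ℓ (![x, y, w] 2)) = ![x, y, ℓ w] := by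
    funext i; fin_cases i <;> rfl
  rw [e0, e1, e2] at h0
  exact h0

/-- The three rotation generators `L₀, L₁, L₂` of the registered statement (operators of the antisymmetric
matrices `-ε_{a··}`) are skew: `Lₐ* = -Lₐ` (`Matrix.toEuclideanCLM` is a star-algebra isomorphism and
`Lₐᴴ = -Lₐ` entrywise). -/
theorem star_axisGen (a : Fin 3) :
    star (Matrix.toEuclideanCLM (n := Fin 3) (𝕜 := ℝ)
        (![!![0, 0, 0; 0, 0, -1; 0, 1, 0], !![0, 0, 1; 0, 0, 0; -1, 0, 0], !![0, -1, 0; 1, 0, 0; 0, 0, 0]] a)) =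
      -Matrix.toEuclideanCLM (n := Fin 3) (𝕜 := ℝ)
        (![!![0, 0, 0; 0, 0, -1; 0, 1, 0], !![0, 0, 1; 0, 0, 0; -1, 0, 0], !![0, -1, 0; 1, 0, 0; 0, 0, 0]] a) := by
  rw [← map_neg, ← map_star]
  congr 1
  rw [Matrix.star_eq_conjTranspose]
  fin_cases a <;> (ext i j; fin_cases i <;> fin_cases j <;> simp)

/-- **The tensor equations** (item stmt-NavierStokesRegularity-1377, route OddMorawetz, stub
`stub_infinitesimalInvariance`). If a smooth density on 3-jets is invariant under every linear isometry of
`ℝ³` (acting by `jetAct`), then its third derivative at the origin is annihilated by the three rotation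
generators acting as derivations: `D(ℓₐx, y, w) + D(x, ℓₐy, w) + D(x, y, ℓₐw) = 0`, where `Lₐ` is the rotation
generator about the axis `eₐ` (the matrix `-ε_{a··}`) and `ℓₐ` its induced derivation on jets,
`ℓₐ(z₀, z₁, z₂, z₃) = (Lₐz₀, Lₐ∘z₁ − z₁∘Lₐ, Lₐ∘z₂ − z₂∘(Lₐ,1) − z₂∘(1,Lₐ), …)` — the curve of rotations
`θ ↦ exp (θLₐ)` in `iteratedFDeriv_three_jetDeriv_eq_zero` (`star_axisGen`, `jetAct_expUnitary_zero`,
`hasDerivAt_jetAct_expUnitary`). -/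
theorem stub_infinitesimalInvariance :
    ∀ (m : Jet3 → ℝ), ContDiff ℝ (⊤ : ℕ∞) m → (∀ (g : E3 ≃ₗᵢ[ℝ] E3) (z : Jet3), m (jetAct g z) = m z) →
      ∀ (a : Fin 3),
      let L : E3 →L[ℝ] E3 := Matrix.toEuclideanCLM (n := Fin 3) (𝕜 := ℝ)
        (![!![0, 0, 0; 0, 0, -1; 0, 1, 0], !![0, 0, 1; 0, 0, 0; -1, 0, 0], !![0, -1, 0; 1, 0, 0; 0, 0, 0]] a);
      let ℓ : Jet3 → Jet3 := fun z =>
        (L z.1,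
          L.compContinuousMultilinearMap z.2.1 -
            ∑ s : Fin 1, z.2.1.compContinuousLinearMap (Function.update (fun _ => ContinuousLinearMap.id ℝ E3) s L),
          L.compContinuousMultilinearMap z.2.2.1 -
            ∑ s : Fin 2, z.2.2.1.compContinuousLinearMap (Function.update (fun _ => ContinuousLinearMap.id ℝ E3) s L),
          L.compContinuousMultilinearMap z.2.2.2 -
            ∑ s : Fin 3, z.2.2.2.compContinuousLinearMap (Function.update (fun _ => ContinuousLinearMap.id ℝ E3) s L));
      ∀ (x y w : Jet3),
        iteratedFDeriv ℝ 3 m 0 ![ℓ x, y, w] + iteratedFDeriv ℝ 3 m 0 ![x, ℓ y, w] +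
          iteratedFDeriv ℝ 3 m 0 ![x, y, ℓ w] = 0 := by
  intro m hm hinv a L ℓ x y w
  exact iteratedFDeriv_three_jetDeriv_eq_zero hm hinv
    (fun θ => Unitary.linearIsometryEquiv ⟨exp (θ • L), exp_smul_mem_unitary_of_skew L (star_axisGen a) θ⟩) ℓ
    (jetAct_expUnitary_zero L (star_axisGen a)) (hasDerivAt_jetAct_expUnitary L (star_axisGen a)) x y w

end Summit.NavierStokesRegularity.NavierStokesRegularity.Theorems
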